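import Literature.NumberTheory.Rogawski1990.ArchTransfFamilyJumpPartners     -- ★ p850304 (LH7-p02 (g2)) PART 2b: the six classes at order 0, `twisted_hcSwapAt_zero_one`, covered slot signs; brings PART 2a Kit, ★ Resolved
import Literature.NumberTheory.Rogawski1990.ArchTransfFamilyWallGeometry     -- ★ (F0P3a-p09 (g5)) B1: `hcSwapAt_hcAdaptedVec` (eigen-signs of the letters), `hcSwapAt_hcNrm`
import Literature.Analysis.Calculus.BoundedJetsLeibnizReflection              -- ★ p850096 (F0P3a-p02 (g19)): `iteratedFDeriv_comp_continuousLinearEquiv_apply(_of_eigen)`, `prod_eq_neg_one_pow_card`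
import HarnessLib

/-!
# (I₃) for the candidate transfer family — PART 3a (JETS): the one-sided JETS of the twisted partner terms at a covered wall, all orders
# (Shelstad 1979 Lemma 4.3, Prop. 4.5, Thm. 4.7 (IIIb) p. 31; Bouaziz 1994 §3.2 (I₃); Rogawski 1990 §4.3)

Topic `NumberTheory/Rogawski1990`; namespace `Literature.NumberTheory.Rogawski1990`.  THEOREMS ONLY (no `def`, no instance, no notation, no axiom, no named fact, no `sorry`).
Cell `pub/hodgecm-mathlib`, line LH3 (closer stub `stub_N9`, crux H413 = `stmt-HodgeConjecture-24833`), organ **O-L2 (I₃-TRANSF)**, ED. 3 brick (W1) of the (P) «pointwise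
all orders» half (LH3-plan (g3) 2026-09-02T07:53Z «= SPLIT»; author LH7-p02 (g2)).  HONEST LABEL: HC_CM is proved only modulo the 7 printed citations (2 remaining: hLiu418 =
`stmt-HodgeConjecture-24832`, h413 = `stmt-HodgeConjecture-24833`) until rung 0 closes; count-neutral.

THE MATHEMATICS.  PART 2b did order `0`; here the same six-class analysis is run on the JETS.  At a `G`-semiregular point `p` of the covered wall `w₀ ∉ S` and for a word `u` of
adapted letters (★ `bzAdaptedVec w₀ = hcAdaptedVec w₀ 0 2`, §1), the reference jet `g_u(t) = Dʲ'F_S(p + t•nrm w₀)(u)` (`'F_S = archERhoG S · F S`) jumps by HC's (I₃)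
`J(u) = jc′ S w₀ 0 2 · I^{a(u)} · Dʲ'F_{S″}(cayPt w₀ p)(Cayley u)`, `a(u)` = number of normal letters (★ `ArchHcJump`, all orders).  The pure relabelling `σ ∈ S₃` at `w₀` reads
(§2 `hasOneSidedJump_jet_slotPerm_update_one`): `σ = 1`: `g_u(t)`; `σ = (01)`: `−g_u(t)` off `t = 0` («`'F_S∘swap₀₁ = −'F_S`», PART 2b, transported by `Filter.EventuallyEq.iteratedFDeriv`);
`σ = (02)`: `(−1)^{a(u)}·g_u(−t)` — the letters are EIGENVECTORS of the slot swap (★ `hcSwapAt_hcAdaptedVec`: the normal letter flips, the others are fixed; ★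
`iteratedFDeriv_comp_continuousLinearEquiv_apply_of_eigen`); `σ = (012)`: `−(−1)^{a(u)}·g_u(−t)`; the two `σ` with `σ⁻¹1 = 2`: continuous (compact pair, (I₁)).  So the jump of
the class `σ` is `sign σ · o_σ(u) · J(u)` with the ORIENTATION factor `o_σ(u) = 1` if `σ⁻¹0 < σ⁻¹2` and `(−1)^{a(u)}` otherwise; with `κ_{ρ′σ} = sign σ·κ_{ρ′}` (PART 2b) the partner
`ρ = ρ′σ` contributes `κ_{ρ′}·o_σ(u)·J_{ρ′}(u)` (§3 `hasOneSidedJump_kappa_jet_partner`, the word re-lettered by `ρ′` at the other places), and the four jumping classes add up to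
`(2 + 2(−1)^{a(u)})·κ_{ρ′}·J_{ρ′}(u)` — ODD normal jets of the partner sum do not jump (the classes `1, (02)` read `g(t) − g(−t)`), matching the Cayley side where an odd number of
`∂_x` letters kills the `x`-even `'F_{S″}` (PART 3c).  The Cayley data are rewritten on the `S″`-chart: `I^{a}` = ★ `bzCayScalar w₀ u`, the Cayley word = ★ `bzCayVec ∘ u`
re-lettered by `ρ′`, i.e. `Dʲ('F_{S″} ∘ slotPerm ρ′)(cayPt w₀ p)(bzCayVec ∘ u)`.

## References
* [Shelstad1979] D. Shelstad, *Characters and inner forms of a quasi-split group over ℝ*, Compositio Math. 39 (1979), §4: (II) p. 23, Lemma 4.3 p. 25, Prop. 4.5 p. 26,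
  Thm. 4.7 (IIIb) p. 31.
* [Bouaziz1994IntegralesOrbitales] A. Bouaziz, *Intégrales orbitales sur les groupes de Lie réductifs*, Ann. Sci. ÉNS 27 (1994), §3.2 (I₁)–(I₃) pp. 579–580, §6.2 p. 591.
* [Rogawski1990] J. D. Rogawski, *Automorphic Representations of Unitary Groups in Three Variables* (1990), §4.3 (4.3.1) p. 43, §8.2 pp. 119–123.
-/

set_option autoImplicit false

noncomputable section

open NumberField NumberField.InfinitePlace Complex Set Filter Topology Equiv Finset
open scoped Classical Real ContDiff
open Literature.NumberTheory.Automorphic Literature.NumberTheory.Automorphic.UnitaryGroup Literature.NumberTheory.Automorphic.ArchCartan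
open Literature.NumberTheory.Automorphic.Shelstad1979.StableOrbitalIntegrals
open Literature.NumberTheory.GaloisRepresentations
open Literature.Analysis.Calculus

namespace Literature.NumberTheory.Rogawski1990

/-! ## §1 Letters: `bzAdaptedVec = hcAdaptedVec · 0 2`, `bzCayVec = hcCayVec · 0 2`; re-lettering by a `w₀`-trivial `ρ′`; the `(02)` eigen-signs -/

section Letters

variable {W : Type*} [DecidableEq W]

/-- The `H`-side adapted letters ARE the `G′`-side adapted letters of the pair `(0, 2)`. [cite: Shelstad1979, Lemma 4.3 (p. 25)] -/
theorem bzAdaptedVec_eq_hcAdaptedVec (w₀ : W) : bzAdaptedVec w₀ = hcAdaptedVec w₀ 0 2 := by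
  funext l
  obtain ⟨w, i⟩ := l
  unfold bzAdaptedVec hcAdaptedVec
  by_cases hw : w = w₀
  · subst hw
    simp only [if_true]
    have e0 : (![![(1 : ℝ), 0, -1], ![0, 1, 0], ![1, 0, 1]] : Fin 3 → Fin 3 → ℝ) 0 = Pi.single (0 : Fin 3) (1 : ℝ) - Pi.single 2 1 := by
      funext j; fin_cases j <;> simp
    have e1 : (![![(1 : ℝ), 0, -1], ![0, 1, 0], ![1, 0, 1]] : Fin 3 → Fin 3 → ℝ) 1 = Pi.single (1 : Fin 3) (1 : ℝ) := by
      funext j; fin_cases j <;> simp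
    have e2 : (![![(1 : ℝ), 0, -1], ![0, 1, 0], ![1, 0, 1]] : Fin 3 → Fin 3 → ℝ) 2 = Pi.single (0 : Fin 3) (1 : ℝ) + Pi.single 2 1 := by
      funext j; fin_cases j <;> simp
    fin_cases i
    · simp [e0]
    · simp [e1]
    · simp [e2]
  · simp [hw]

/-- The `H`-side Cayley letters ARE the `G′`-side Cayley letters of the pair `(0, 2)`. [cite: Shelstad1979, Lemma 4.3 (p. 25)] -/
theorem bzCayVec_eq_hcCayVec (w₀ : W) : (bzCayVec : W × Fin 3 → W → Fin 3 → ℝ) = hcCayVec w₀ 0 2 := by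
  funext l
  obtain ⟨w, i⟩ := l
  unfold bzCayVec hcCayVec
  by_cases hw : w = w₀
  · subst hw
    simp only [if_true]
    fin_cases i
    · simp
    · simp
    · simp
  · simp [hw]

/-- The `H`-side Cayley scalar IS the `G′`-side one of the pair `(0, 2)`. [cite: Shelstad1979, Lemma 4.3 (p. 25)] -/
theorem bzCayScalar_eq_hcCayScalar (w₀ : W) {n : ℕ} (m : Fin n → W × Fin 3) : bzCayScalar w₀ m = hcCayScalar w₀ 0 m := rfl

/-- `slotPerm ρ` on a one-place vector: `slotPerm ρ (Pi.single w v) = Pi.single w (v ∘ ρ w)`. [cite: Shelstad1979, Lemma 4.2 (p. 23)] -/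
theorem slotPerm_single (ρ : W → Perm (Fin 3)) (w : W) (v : Fin 3 → ℝ) : slotPerm ρ (Pi.single w v) = Pi.single w (v ∘ ⇑(ρ w)) := by
  funext w' j
  rw [slotPerm_apply]
  by_cases h : w' = w
  · subst h; simp
  · simp [Pi.single_eq_of_ne h]

omit [DecidableEq W] in
/-- A slot permutation re-letters a coordinate vector: `Pi.single i 1 ∘ σ = Pi.single (σ⁻¹ i) 1`. [cite: Shelstad1979, Lemma 4.2 (p. 23)] -/
theorem single_one_comp_perm (σ : Perm (Fin 3)) (i : Fin 3) : (Pi.single i (1 : ℝ) : Fin 3 → ℝ) ∘ ⇑σ = Pi.single (σ.symm i) 1 := by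
  funext j
  simp only [Function.comp_apply, Pi.single_apply, Equiv.apply_eq_iff_eq_symm_apply]

/-- **Re-lettering by a `w₀`-trivial `ρ′`**: `slotPerm ρ′ (bzAdaptedVec w₀ l) = bzAdaptedVec w₀ (l.1, (ρ′ l.1)⁻¹ l.2)` (`ρ′ w₀ = 1`: the letters at `w₀` are kept, a letter
`(w, i)` elsewhere becomes `(w, ρ′_w⁻¹ i)`). [cite: Shelstad1979, Lemma 4.2 (p. 23); Lemma 4.3 (p. 25)] -/
theorem slotPerm_bzAdaptedVec {ρ' : W → Perm (Fin 3)} {w₀ : W} (h : ρ' w₀ = 1) (l : W × Fin 3) :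
    slotPerm ρ' (bzAdaptedVec w₀ l) = bzAdaptedVec w₀ (l.1, (ρ' l.1).symm l.2) := by
  obtain ⟨w, i⟩ := l
  unfold bzAdaptedVec
  by_cases hw : w = w₀
  · subst hw
    simp only [if_true, slotPerm_single, h, Equiv.Perm.coe_one, Function.comp_id]
    rfl
  · simp only [hw, if_false, slotPerm_single, single_one_comp_perm]

/-- Re-lettering the Cayley letters: `slotPerm ρ′ (bzCayVec l) = bzCayVec (l.1, (ρ′ l.1)⁻¹ l.2)`. [cite: Shelstad1979, Lemma 4.3 (p. 25)] -/
theorem slotPerm_bzCayVec (ρ' : W → Perm (Fin 3)) (l : W × Fin 3) : slotPerm ρ' (bzCayVec l) = bzCayVec (l.1, (ρ' l.1).symm l.2) := by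
  obtain ⟨w, i⟩ := l
  unfold bzCayVec
  rw [slotPerm_single, single_one_comp_perm]

/-- Re-lettering does not change the number of normal letters (`ρ′ w₀ = 1`). [cite: Shelstad1979, Lemma 4.3 (p. 25)] -/
theorem bzCayScalar_reletter {ρ' : W → Perm (Fin 3)} {w₀ : W} (h : ρ' w₀ = 1) {n : ℕ} (u : Fin n → W × Fin 3) :
    bzCayScalar w₀ (fun r => ((u r).1, (ρ' (u r).1).symm (u r).2)) = bzCayScalar w₀ u := by
  unfold bzCayScalar
  congr 2
  ext r
  simp only [Finset.mem_filter, Finset.mem_univ, true_and, Prod.mk.injEq]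
  constructor
  · rintro ⟨h1, h2⟩
    refine Prod.ext h1 ?_
    rw [h1, h, ← Equiv.Perm.inv_def, inv_one, Equiv.Perm.coe_one, id_eq] at h2
    exact h2
  · intro hr
    rw [hr, h, ← Equiv.Perm.inv_def, inv_one, Equiv.Perm.coe_one, id_eq]
    exact ⟨rfl, rfl⟩

/-- **The `(02)` eigen-signs**: the slot swap `(02)` at `w₀` FLIPS the normal letter and fixes every other adapted letter. [cite: Shelstad1979, §4 (II) p. 23; Lemma 4.3 (p. 25)] -/
theorem slotPerm_update_one_swap_zero_two_bzAdaptedVec (w₀ : W) (l : W × Fin 3) :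
    slotPerm (Function.update (1 : W → Perm (Fin 3)) w₀ (swap 0 2)) (bzAdaptedVec w₀ l) = (if l = (w₀, 0) then (-1 : ℝ) else 1) • bzAdaptedVec w₀ l := by
  rw [slotPerm_update_one, bzAdaptedVec_eq_hcAdaptedVec]
  exact hcSwapAt_hcAdaptedVec w₀ (show (0 : Fin 3) ≠ 2 by decide) l

end Letters

/-! ## §2 The six classes on the JETS at a `G`-semiregular wall point -/

section SixJet

variable (L : Type) [Field L] [NumberField L] [IsCMField L] (α : Fin 3 → L)

omit [IsCMField L] in
/-- **Jets through a slot relabelling**: `Dʲ('F ∘ slotPerm τ)(c)(d) = Dʲ'F(slotPerm τ c)(slotPerm τ ∘ d)` (★ `exists_continuousLinearEquiv_eq_slotPerm` + ★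
`iteratedFDeriv_comp_continuousLinearEquiv_apply`). [cite: Shelstad1979, §4 (II) p. 23] -/
theorem iteratedFDeriv_comp_slotPerm_apply (G : ({w : InfinitePlace L // IsComplex w} → Fin 3 → ℝ) → ℂ) (τ : {w : InfinitePlace L // IsComplex w} → Perm (Fin 3))
    (c : {w : InfinitePlace L // IsComplex w} → Fin 3 → ℝ) (j : ℕ) (d : Fin j → {w : InfinitePlace L // IsComplex w} → Fin 3 → ℝ) :
    iteratedFDeriv ℝ j (fun c => G (slotPerm τ c)) c d = iteratedFDeriv ℝ j G (slotPerm τ c) (fun i => slotPerm τ (d i)) := by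
  obtain ⟨P, hP⟩ := exists_continuousLinearEquiv_eq_slotPerm τ
  have hcomp : (fun c => G (slotPerm τ c)) = G ∘ P := by funext c; rw [Function.comp_apply, hP]
  rw [hcomp, iteratedFDeriv_comp_continuousLinearEquiv_apply, hP]
  congr 1
  funext i
  exact hP (d i)

omit [IsCMField L] in
/-- **The `(02)`-relabelled jets are the REFLECTED jets with the eigen-sign `(−1)^{a(u)}`**: at a wall point `p` (`p_{w₀0} = p_{w₀2}`),
`Dʲ('F∘(02))(p + t•nrm w₀)(bzAdaptedVec∘u) = (−1)^{#normal letters} · Dʲ'F(p − t•nrm w₀)(bzAdaptedVec∘u)`. [cite: Shelstad1979, §4 (II) p. 23; Thm. 4.7 proof p. 31] -/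
theorem iteratedFDeriv_comp_swap_zero_two_apply (G : ({w : InfinitePlace L // IsComplex w} → Fin 3 → ℝ) → ℂ) {w₀ : {w : InfinitePlace L // IsComplex w}}
    {p : {w : InfinitePlace L // IsComplex w} → Fin 3 → ℝ} (hs02 : p w₀ 0 = p w₀ 2) (t : ℝ) (j : ℕ) (u : Fin j → {w : InfinitePlace L // IsComplex w} × Fin 3) :
    iteratedFDeriv ℝ j (fun c => G (slotPerm (Function.update (1 : {w : InfinitePlace L // IsComplex w} → Perm (Fin 3)) w₀ (swap 0 2)) c)) (p + t • nrm w₀)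
        (fun i => bzAdaptedVec w₀ (u i)) =
      (((-1 : ℝ) ^ (Finset.univ.filter fun r => u r = (w₀, 0)).card : ℝ) : ℂ) *
        iteratedFDeriv ℝ j G (p + (-t) • nrm w₀) (fun i => bzAdaptedVec w₀ (u i)) := by
  obtain ⟨P, hP⟩ := exists_continuousLinearEquiv_eq_slotPerm (Function.update (1 : {w : InfinitePlace L // IsComplex w} → Perm (Fin 3)) w₀ (swap 0 2))
  have hcomp : (fun c => G (slotPerm (Function.update (1 : {w : InfinitePlace L // IsComplex w} → Perm (Fin 3)) w₀ (swap 0 2)) c)) = G ∘ P := by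
    funext c; rw [Function.comp_apply, hP]
  have heig : ∀ i, P (bzAdaptedVec w₀ (u i)) = (if u i = (w₀, 0) then (-1 : ℝ) else 1) • bzAdaptedVec w₀ (u i) := fun i => by
    rw [hP]; exact slotPerm_update_one_swap_zero_two_bzAdaptedVec w₀ (u i)
  have hfilter : (Finset.univ.filter fun i => (if u i = (w₀, 0) then (-1 : ℝ) else 1) = -1) = Finset.univ.filter fun r => u r = (w₀, 0) := by
    ext r
    simp only [Finset.mem_filter, Finset.mem_univ, true_and]
    constructor
    · intro h
      by_contra hne
      rw [if_neg hne] at h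
      norm_num at h
    · intro h
      rw [if_pos h]
  rw [hcomp, iteratedFDeriv_comp_continuousLinearEquiv_apply_of_eigen P G _ j heig, hP, slotPerm_update_one_swap_zero_two_add_smul_nrm hs02,
    prod_eq_neg_one_pow_card (fun i => by by_cases h : u i = (w₀, 0) <;> simp [h]), hfilter, Complex.real_smul]

omit [IsCMField L] in
/-- **`'F ∘ swap₀₁ = −'F` NEAR a `G`-regular point, on the jets**: for `c₀ ∈ RegG S` (`w₀ ∉ S` covered, (W)),
`Dʲ('F_S ∘ swap₀₁ ∘ slotPerm τ)(x)(d) = −Dʲ('F_S ∘ slotPerm τ)(x)(d)` whenever `slotPerm τ x ∈ RegG S`. [cite: Shelstad1979, §4 (II) p. 23] -/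
theorem iteratedFDeriv_comp_swap_zero_one_of_mem_regG {S : Finset {w : InfinitePlace L // IsComplex w}} {w₀ : {w : InfinitePlace L // IsComplex w}} (hw₀ : w₀ ∉ S)
    (h01 : slotSign L α w₀ 0 = slotSign L α w₀ 1)
    {F : Finset {w : InfinitePlace L // IsComplex w} → ({w : InfinitePlace L // IsComplex w} → Fin 3 → ℝ) → ℂ} (hW : ArchHcWeyl (slotSign L α) F)
    (τ : {w : InfinitePlace L // IsComplex w} → Perm (Fin 3)) {x : {w : InfinitePlace L // IsComplex w} → Fin 3 → ℝ} (hx : slotPerm τ x ∈ RegG S) (j : ℕ)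
    (d : Fin j → {w : InfinitePlace L // IsComplex w} → Fin 3 → ℝ) :
    iteratedFDeriv ℝ j (fun c => archERhoG S (slotPerm (Function.update (1 : {w : InfinitePlace L // IsComplex w} → Perm (Fin 3)) w₀ (swap 0 1)) (slotPerm τ c)) *
        F S (slotPerm (Function.update (1 : {w : InfinitePlace L // IsComplex w} → Perm (Fin 3)) w₀ (swap 0 1)) (slotPerm τ c))) x d =
      -iteratedFDeriv ℝ j (fun c => archERhoG S (slotPerm τ c) * F S (slotPerm τ c)) x d := by
  have hopen : ∀ᶠ c in 𝓝 x, slotPerm τ c ∈ RegG S := (continuous_slotPerm τ).continuousAt.eventually ((isOpen_regG S).mem_nhds hx)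
  have hEq : (fun c => archERhoG S (slotPerm (Function.update (1 : {w : InfinitePlace L // IsComplex w} → Perm (Fin 3)) w₀ (swap 0 1)) (slotPerm τ c)) *
        F S (slotPerm (Function.update (1 : {w : InfinitePlace L // IsComplex w} → Perm (Fin 3)) w₀ (swap 0 1)) (slotPerm τ c))) =ᶠ[𝓝 x]
      -(fun c => archERhoG S (slotPerm τ c) * F S (slotPerm τ c)) := by
    filter_upwards [hopen] with c hc
    rw [Pi.neg_apply, slotPerm_update_one]
    exact twisted_hcSwapAt_zero_one L α hw₀ h01 hW (archRG_ne_zero_of_mem_regG hc)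
  rw [(Filter.EventuallyEq.iteratedFDeriv ℝ hEq j).self_of_nhds, iteratedFDeriv_neg_apply, _root_.neg_apply]

omit [IsCMField L] in
/-- **Continuity of the twisted partner jets through a tame point**: if `slotPerm τ p ∈ InRegG (slotSign L α) S` then `t ↦ Dʲ('F_S ∘ slotPerm τ)(p + t•nrm w₀)(d)` is
continuous at `t = 0` ((I₁)). [cite: Bouaziz1994IntegralesOrbitales, §3.2 (I₁) p. 579] -/
theorem tendsto_iteratedFDeriv_twisted_slotPerm {S : Finset {w : InfinitePlace L // IsComplex w}}
    {F : Finset {w : InfinitePlace L // IsComplex w} → ({w : InfinitePlace L // IsComplex w} → Fin 3 → ℝ) → ℂ} (hI1 : ContDiffOn ℝ ∞ (F S) (InRegG (slotSign L α) S))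
    (τ : {w : InfinitePlace L // IsComplex w} → Perm (Fin 3)) {p : {w : InfinitePlace L // IsComplex w} → Fin 3 → ℝ} (hp : slotPerm τ p ∈ InRegG (slotSign L α) S)
    (w₀ : {w : InfinitePlace L // IsComplex w}) (j : ℕ) (d : Fin j → {w : InfinitePlace L // IsComplex w} → Fin 3 → ℝ) :
    Tendsto (fun t : ℝ => iteratedFDeriv ℝ j (fun c => archERhoG S (slotPerm τ c) * F S (slotPerm τ c)) (p + t • nrm w₀) d) (𝓝 (0 : ℝ))
      (𝓝 (iteratedFDeriv ℝ j (fun c => archERhoG S (slotPerm τ c) * F S (slotPerm τ c)) p d)) := by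
  -- `'F_S ∘ slotPerm τ` is `C^∞` near `p`
  have hO : IsOpen (slotPerm τ ⁻¹' InRegG (slotSign L α) S) := (isOpen_inRegG _ S).preimage (continuous_slotPerm τ)
  have hG : ContDiffOn ℝ ∞ (fun c => archERhoG S (slotPerm τ c) * F S (slotPerm τ c)) (slotPerm τ ⁻¹' InRegG (slotSign L α) S) := by
    refine (contDiff_archERhoG_slotPerm S τ).contDiffOn.mul ?_
    obtain ⟨P, hP⟩ := exists_continuousLinearEquiv_eq_slotPerm τ
    have hcomp : (fun c : {w : InfinitePlace L // IsComplex w} → Fin 3 → ℝ => F S (slotPerm τ c)) = F S ∘ P := by funext c; rw [Function.comp_apply, hP]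
    rw [hcomp]
    exact hI1.comp P.contDiff.contDiffOn fun c hc => by rw [hP]; exact hc
  have hAt : ContDiffAt ℝ ∞ (fun c => archERhoG S (slotPerm τ c) * F S (slotPerm τ c)) p := (hG p hp).contDiffAt (hO.mem_nhds hp)
  have hcont : ContinuousAt (iteratedFDeriv ℝ j (fun c => archERhoG S (slotPerm τ c) * F S (slotPerm τ c))) p :=
    hAt.continuousAt_iteratedFDeriv (by exact_mod_cast le_top)
  have hcurve : Tendsto (fun t : ℝ => p + t • nrm w₀) (𝓝 (0 : ℝ)) (𝓝 p) := by
    have hc : Continuous fun t : ℝ => p + t • nrm w₀ := continuous_const.add (continuous_id.smul continuous_const)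
    have h := hc.tendsto 0
    simp only [zero_smul, add_zero] at h
    exact h
  exact ((continuous_eval_const d).tendsto _).comp (hcont.tendsto.comp hcurve)

omit [IsCMField L] in
/-- **THE SIX CLASSES ON THE JETS (all orders).**  `w₀ ∉ S` covered, `p` a `G`-semiregular point of the `H`-wall, `F ∈ ArchHCSpaceG (slotSign L α) jc′`, `u` a word of adapted
letters; for the pure relabelling `σ ∈ S₃` at `w₀`, `t ↦ Dʲ('F_S ∘ σ)(p + t•nrm w₀)(bzAdaptedVec∘u)` has one-sided limits at `0` with jump
`sign σ · o_σ(u) · jc′ S w₀ 0 2 · I^{a(u)} · Dʲ'F_{S″}(cayPt w₀ p)(Cayley u)` if `σ⁻¹1 ≠ 2` (`o_σ(u) = 1` if `σ⁻¹0 < σ⁻¹2`, `(−1)^{a(u)}` else), and `0` if `σ⁻¹1 = 2`.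
[cite: Shelstad1979, Lemma 4.3 p. 25; Thm. 4.7 (IIIb) p. 31] [cite: Bouaziz1994IntegralesOrbitales, §3.2 (I₃) p. 580] -/
theorem hasOneSidedJump_jet_slotPerm_update_one (hα : ∀ i, α i ≠ 0) {S : Finset {w : InfinitePlace L // IsComplex w}}
    {w₀ : {w : InfinitePlace L // IsComplex w}} (hw₀ : w₀ ∉ S) (hcov : w₀ ∈ splitChartPlaces L α)
    {jc' : Finset {w : InfinitePlace L // IsComplex w} → {w : InfinitePlace L // IsComplex w} → Fin 3 → Fin 3 → ℂ}
    {F : Finset {w : InfinitePlace L // IsComplex w} → ({w : InfinitePlace L // IsComplex w} → Fin 3 → ℝ) → ℂ} (hF : ArchHCSpaceG (slotSign L α) jc' F)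
    {p : {w : InfinitePlace L // IsComplex w} → Fin 3 → ℝ} (hs02 : p w₀ 0 = p w₀ 2) (hs1 : Circle.exp (p w₀ 1) ≠ Circle.exp (p w₀ 0))
    (hreg : ∀ v, v ∉ S → v ≠ w₀ → Function.Injective fun i : Fin 3 => Circle.exp (p v i)) (hx : ∀ v ∈ S, p v 0 ≠ 0) (σ : Perm (Fin 3))
    (j : ℕ) (u : Fin j → {w : InfinitePlace L // IsComplex w} × Fin 3) :
    HasOneSidedJump
      (fun t : ℝ => iteratedFDeriv ℝ j
        (fun c => archERhoG S (slotPerm (Function.update (1 : {w : InfinitePlace L // IsComplex w} → Perm (Fin 3)) w₀ σ) c) *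
          F S (slotPerm (Function.update (1 : {w : InfinitePlace L // IsComplex w} → Perm (Fin 3)) w₀ σ) c)) (p + t • nrm w₀) (fun i => bzAdaptedVec w₀ (u i)))
      (if σ.symm 1 ≠ 2 then
        (Equiv.Perm.sign σ : ℂ) * (if σ.symm 0 < σ.symm 2 then (1 : ℂ) else (((-1 : ℝ) ^ (Finset.univ.filter fun r => u r = (w₀, 0)).card : ℝ) : ℂ)) *
          (jc' S w₀ 0 2 * (bzCayScalar w₀ u *
            iteratedFDeriv ℝ j (fun c => archERhoG (insert w₀ S) c * F (insert w₀ S) c) (cayPt w₀ p) (fun i => bzCayVec (u i))))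
       else 0) := by
  obtain ⟨h10, -, -⟩ := slotSign_of_mem_splitChartPlaces L α hα hcov
  obtain ⟨h02, -⟩ := slotSign_zero_ne_two_of_mem_splitChartPlaces L α hα hcov
  have hsemi : HcSemireg S w₀ 0 2 p := ⟨hs02, by rw [show hcThird (0 : Fin 3) 2 = 1 from by decide]; exact hs1, hreg, hx⟩
  -- HC's jump of the reference jet `g_u`
  have hg : HasOneSidedJump (fun t : ℝ => iteratedFDeriv ℝ j (fun c => archERhoG S c * F S c) (p + t • nrm w₀) (fun i => bzAdaptedVec w₀ (u i)))
      (jc' S w₀ 0 2 * (bzCayScalar w₀ u * iteratedFDeriv ℝ j (fun c => archERhoG (insert w₀ S) c * F (insert w₀ S) c) (cayPt w₀ p) (fun i => bzCayVec (u i)))) := by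
    have h := hF.2.2.2.2 S w₀ hw₀ 0 2 (show (0 : Fin 3) ≠ 2 by decide) h02 p hsemi j u
    rw [hcNrm_zero_two, hcCayPt_zero_two, ← bzAdaptedVec_eq_hcAdaptedVec, ← bzCayVec_eq_hcCayVec w₀, ← bzCayScalar_eq_hcCayScalar, mul_assoc] at h
    exact h
  obtain ⟨hev, hevn⟩ := eventually_nhdsNE_mem_regG_add_smul_nrm hw₀ hs02 hs1 hreg hx
  have hI1 : ContDiffOn ℝ ∞ (F S) (InRegG (slotSign L α) S) := (hF.2.2.1 S).1
  have hrefl := iteratedFDeriv_comp_swap_zero_two_apply L (fun c => archERhoG S c * F S c) hs02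
  rcases perm_fin_three_eq σ with rfl | rfl | rfl | rfl | rfl | rfl
  · -- `σ = 1`
    have e1 : Function.update (1 : {w : InfinitePlace L // IsComplex w} → Perm (Fin 3)) w₀ 1 = 1 := by
      funext v; by_cases hv : v = w₀
      · subst hv; rw [Function.update_self, Pi.one_apply]
      · rw [Function.update_of_ne hv]
    rw [if_pos (by decide), if_pos (by decide), Equiv.Perm.sign_one, Units.val_one, Int.cast_one, one_mul, one_mul]
    simp only [e1, slotPerm_one]
    exact hg
  · -- `σ = (01)`: `−g_u(t)` off `t = 0`
    rw [if_pos (by decide), if_pos (by decide), Equiv.Perm.sign_swap (by decide), Units.val_neg, Units.val_one, Int.cast_neg, Int.cast_one, mul_one]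
    refine HasOneSidedJump.jump_congr (hasOneSidedJump_congr_eventuallyEq (hasOneSidedJump_neg hg) ?_) (by ring)
    filter_upwards [hev] with t ht
    have h := iteratedFDeriv_comp_swap_zero_one_of_mem_regG L α hw₀ h10.symm hF.2.1 (1 : {w : InfinitePlace L // IsComplex w} → Perm (Fin 3))
      (x := p + t • nrm w₀) (by simpa only [slotPerm_one] using ht) j (fun i => bzAdaptedVec w₀ (u i))
    simp only [slotPerm_one] at h
    exact h.symm
  · -- `σ = (02)`: `(−1)^a · g_u(−t)`
    rw [if_pos (by decide), if_neg (by decide), Equiv.Perm.sign_swap (by decide), Units.val_neg, Units.val_one, Int.cast_neg, Int.cast_one]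
    simp only [hrefl]
    exact HasOneSidedJump.jump_congr (HasOneSidedJump.const_mul ((((-1 : ℝ) ^ (Finset.univ.filter fun r => u r = (w₀, 0)).card : ℝ) : ℂ))
      (hasOneSidedJump_comp_neg hg)) (by ring)
  · -- `σ = (12)`: compact pair, continuous
    rw [if_neg (by decide)]
    have e0 : Circle.exp (p w₀ ((swap (1 : Fin 3) 2) 0)) = Circle.exp (p w₀ 0) := by
      rw [Equiv.swap_apply_of_ne_of_ne (by decide) (by decide)]
    have e1 : Circle.exp (p w₀ ((swap (1 : Fin 3) 2) 1)) = Circle.exp (p w₀ 0) := by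
      rw [Equiv.swap_apply_left, hs02]
    exact hasOneSidedJump_zero_of_tendsto
      (tendsto_iteratedFDeriv_twisted_slotPerm L α hI1 _ (slotPerm_update_one_mem_inRegG L α h10 hs1 hreg e0 e1 (Equiv.swap_apply_right 1 2)) w₀ j _)
  · -- `σ = (02)(01) = (0 1 2)`: `−(−1)^a · g_u(−t)` off `t = 0`
    rw [if_pos (by decide), if_neg (by decide), Equiv.Perm.sign_mul, Equiv.Perm.sign_swap (by decide), Equiv.Perm.sign_swap (by decide)]
    simp only [neg_mul, one_mul, neg_neg, Units.val_one, Int.cast_one]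
    simp only [slotPerm_update_one_mul]
    refine HasOneSidedJump.jump_congr (hasOneSidedJump_congr_eventuallyEq (hasOneSidedJump_neg
      (HasOneSidedJump.const_mul ((((-1 : ℝ) ^ (Finset.univ.filter fun r => u r = (w₀, 0)).card : ℝ) : ℂ)) (hasOneSidedJump_comp_neg hg))) ?_) (by ring)
    filter_upwards [hevn] with t ht
    have hxt : slotPerm (Function.update (1 : {w : InfinitePlace L // IsComplex w} → Perm (Fin 3)) w₀ (swap 0 2)) (p + t • nrm w₀) ∈ RegG S := by
      rw [slotPerm_update_one_swap_zero_two_add_smul_nrm hs02]; exact ht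
    rw [iteratedFDeriv_comp_swap_zero_one_of_mem_regG L α hw₀ h10.symm hF.2.1 _ hxt j, hrefl]
  · -- `σ = (01)(02) = (0 2 1)`: compact pair, continuous
    rw [if_neg (by decide)]
    have e0 : Circle.exp (p w₀ ((swap (0 : Fin 3) 1 * swap 0 2 : Perm (Fin 3)) 0)) = Circle.exp (p w₀ 0) := by
      rw [show (swap (0 : Fin 3) 1 * swap 0 2 : Perm (Fin 3)) 0 = 2 from by decide, hs02]
    have e1 : Circle.exp (p w₀ ((swap (0 : Fin 3) 1 * swap 0 2 : Perm (Fin 3)) 1)) = Circle.exp (p w₀ 0) := by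
      rw [show (swap (0 : Fin 3) 1 * swap 0 2 : Perm (Fin 3)) 1 = 0 from by decide]
    have e2 : (swap (0 : Fin 3) 1 * swap 0 2 : Perm (Fin 3)) 2 = 1 := by decide
    exact hasOneSidedJump_zero_of_tendsto
      (tendsto_iteratedFDeriv_twisted_slotPerm L α hI1 _ (slotPerm_update_one_mem_inRegG L α h10 hs1 hreg e0 e1 e2) w₀ j _)

end SixJet



end Literature.NumberTheory.Rogawski1990

end
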